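import Literature.RingTheory.NoetherNormalization.SeparableNagata
import HarnessLib

/-!
# Separable Noether normalisation over a perfect field

Topic `Literature/RingTheory/NoetherNormalization`.  **Theorem** (Nagata, *Local Rings*,
(39.11); Huneke–Swanson, *Integral Closure*, Thm. 4.2.2, last assertion; Eisenbud, Cor. 16.18):
if `K` is a PERFECT field and `B = K[x_1, …, x_n]` is a domain, there are algebraically
independent `y_1, …, y_e ∈ B` with `B` integral over `K[y]` AND `Frac B` separable over `K(y)`.

We prove it for a finite family `x : Fin n → B` in a `K`-domain `B` embedded in a field `L`
(`exists_isIntegral_isSeparable_adjoin`): there are algebraically independent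
`y_1, …, y_e ∈ K[x]` with every `x_i` integral over `K[y]` and separable over the subfield
`K(y) ⊆ L`.  Induction on `n`; the step (`SeparableNagata.lean`): a relation `f(x) = 0` of
minimal total degree is irreducible with some exponent prime to `p` (Mathlib's
`MvPolynomial.exists_mem_support_not_dvd_of_forall_totalDegree_le`, fed by
`linearIndepOn_pow_of_perfectField`), hence `∂f/∂X_i ≠ 0`, hence `(∂f/∂X_i)(x) ≠ 0` by
minimality (`totalDegree_pderiv_lt`); the power shear with base `N = p (deg f + 2)` centred at
that variable makes `x_i` integral over the sheared rest `z` with an integral equation whose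
derivative at `x_i` is a unit times `(∂f/∂X_i)(x) ≠ 0`, so `x_i` is separable over `K(z)`;
the inductive hypothesis normalises `z`, and separability climbs the tower
`K(y) ⊆ K(y)(z) ⊆ K(y)(z)(x_i) ∋ x_j`.  In characteristic `0` separability is automatic.

* `totalDegree_pderiv_lt`, `pderiv_ne_zero_of_not_dvd`, `linearIndepOn_pow_of_perfectField` —
  the auxiliary facts just mentioned;
* `exists_isIntegral_isSeparable_adjoin` — the theorem.

Consumer: `Literature/RingTheory/CohomologyAnnihilator/AffineDomainAnnihilator.lean`
(Iyengar–Takahashi, Thm. 3.6 over perfect fields: `ca^{dim B + 1}(B) ≠ 0`).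

## References

* C. Huneke, I. Swanson, *Integral Closure of Ideals, Rings, and Modules* (2006), Thm. 4.2.2.
  [HunekeSwanson2006]
* R. Hartshorne, *Algebraic Geometry* (1977), Ch. I Thm. 4.8A (separating transcendence bases
  over perfect fields). [Hartshorne1977]
-/

noncomputable section

open Polynomial MvPolynomial

namespace Literature.RingTheory.NoetherNormalization

universe u v

variable {k : Type u} [Field k] {n : ℕ}

/-! ### Auxiliary facts on partial derivatives and minimal relations -/

/-- A non-zero partial derivative has strictly smaller total degree. [folklore] -/
private theorem totalDegree_pderiv_lt {R σ : Type*} [CommSemiring R] {i : σ} {g : MvPolynomial σ R}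
    (h : pderiv i g ≠ 0) : (pderiv i g).totalDegree < g.totalDegree := by
  have hmem : ∀ b ∈ (pderiv i g).support, b + Finsupp.single i 1 ∈ g.support := by
    intro b hb
    rw [MvPolynomial.mem_support_iff, coeff_pderiv] at hb
    exact MvPolynomial.mem_support_iff.mpr (left_ne_zero_of_mul hb)
  have hdeg : ∀ b : σ →₀ ℕ, ((b + Finsupp.single i 1).sum fun _ e => e) =
      (b.sum fun _ e => e) + 1 := by
    intro b
    rw [Finsupp.sum_add_index' (fun _ => rfl) (fun _ _ _ => rfl), Finsupp.sum_single_index rfl]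
  obtain ⟨b₀, hb₀⟩ := support_nonempty.mpr h
  have hpos : 0 < g.totalDegree := by
    have := le_totalDegree (hmem b₀ hb₀)
    rw [hdeg] at this
    omega
  rw [totalDegree]
  refine (Finset.sup_lt_iff hpos).mpr fun b hb => ?_
  have := le_totalDegree (hmem b hb)
  rw [hdeg] at this
  omega

/-- If the exponent of `X_i` in some monomial of `f` is not divisible by the characteristic,
then `∂f/∂X_i ≠ 0`. [folklore] -/
private theorem pderiv_ne_zero_of_not_dvd {σ : Type*} (p : ℕ) [CharP k p] {f : MvPolynomial σ k} {i : σ}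
    {m : σ →₀ ℕ} (hm : m ∈ f.support) (hndvd : ¬ p ∣ m i) : pderiv i f ≠ 0 := by
  have hmi : 1 ≤ m i := Nat.one_le_iff_ne_zero.mpr fun h0 => hndvd (by rw [h0]; exact dvd_zero p)
  have hsub : m - Finsupp.single i 1 + Finsupp.single i 1 = m :=
    tsub_add_cancel_of_le (Finsupp.single_le_iff.mpr hmi)
  intro h
  have hc := coeff_pderiv (i := i) f (m - Finsupp.single i 1)
  rw [h, MvPolynomial.coeff_zero, hsub] at hc
  have hcast : (((m - Finsupp.single i 1 : σ →₀ ℕ) i : ℕ) : k) + 1 = (m i : k) := by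
    have : (m - Finsupp.single i 1 : σ →₀ ℕ) i + 1 = m i := by
      rw [Finsupp.tsub_apply, Finsupp.single_eq_same]; omega
    rw [← this, Nat.cast_add, Nat.cast_one]
  rw [hcast] at hc
  exact mul_ne_zero (MvPolynomial.mem_support_iff.mp hm)
    ((CharP.cast_eq_zero_iff k p (m i)).not.mpr hndvd) hc.symm

/-- Over a PERFECT field of characteristic `p`, `p`-th powers preserve linear independence in
any field extension (the input `H` of Mathlib's separably-generated machinery).
[cite: Hartshorne1977, Ch. I Thm. 4.8A] -/
theorem linearIndepOn_pow_of_perfectField {K L : Type*} [Field K] [Field L] [Algebra K L]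
    [PerfectField K] (p : ℕ) (hp : p.Prime) [CharP K p] (s : Finset L)
    (hs : LinearIndepOn K _root_.id (s : Set L)) : LinearIndepOn K (· ^ p) (s : Set L) := by
  haveI := Fact.mk hp
  have : ExpChar K p := .prime hp
  have : CharP L p := .of_ringHom_of_ne_zero (algebraMap K L) p hp.ne_zero
  apply hs.map_of_injective_injective (frobeniusEquiv K p).symm (frobenius L p).toAddMonoidHom <;>
    simp [frobenius, Algebra.smul_def, mul_pow, ← map_pow, frobeniusEquiv_symm_pow]

/-! ### Separable Noether normalisation of a finite family -/

section SeparableNN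

open scoped IntermediateField

variable (K : Type u) [Field K] [PerfectField K] {B : Type v} [CommRing B] [IsDomain B]
  [Algebra K B] {L : Type*} [Field L] [Algebra K L] [Algebra B L] [IsScalarTower K B L]

omit [PerfectField K] [IsDomain B] [IsScalarTower K B L] in
/-- The trivial case of `exists_isIntegral_isSeparable_adjoin`: an algebraically independent
family normalises itself. [folklore] -/
private theorem exists_isIntegral_isSeparable_adjoin_of_algebraicIndependent {n : ℕ} (x : Fin n → B)
    (hx : AlgebraicIndependent K x) :
    ∃ (e : ℕ) (y : Fin e → B), (∀ i, y i ∈ Algebra.adjoin K (Set.range x)) ∧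
      AlgebraicIndependent K y ∧ (∀ i, IsIntegral (Algebra.adjoin K (Set.range y)) (x i)) ∧
      ∀ i, IsSeparable (IntermediateField.adjoin K (Set.range fun j => algebraMap B L (y j)))
        (algebraMap B L (x i)) := by
  refine ⟨n, x, fun i => Algebra.subset_adjoin ⟨i, rfl⟩, hx,
    fun i => isIntegral_of_mem_subalgebra (Algebra.subset_adjoin ⟨i, rfl⟩), fun i => ?_⟩
  have hmem : algebraMap B L (x i) ∈
      IntermediateField.adjoin K (Set.range fun j => algebraMap B L (x j)) :=
    IntermediateField.subset_adjoin K _ ⟨i, rfl⟩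
  exact isSeparable_algebraMap (F := IntermediateField.adjoin K (Set.range fun j =>
    algebraMap B L (x j))) ⟨_, hmem⟩

omit [PerfectField K] [IsDomain B] in
/-- Pushing `aevalTower` along `B → L` into an intermediate field `E` containing the family:
`H(x) = algebraMap B L (h(z; b))` for `H = h` with coefficients evaluated at `z` inside `E`.
[folklore] -/
private theorem aeval_map_aeval_eq_algebraMap_aevalTower {m : ℕ} {F : Type*} [Field F] [Algebra F L]
    (E : IntermediateField F L) [Algebra K E] [IsScalarTower K E L] (z : Fin m → B)
    (zE : Fin m → E) (hzE : ∀ j, (zE j : L) = algebraMap B L (z j)) (b : B)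
    (P : Polynomial (MvPolynomial (Fin m) K)) :
    Polynomial.aeval (algebraMap B L b)
        (P.map (MvPolynomial.aeval zE : MvPolynomial (Fin m) K →ₐ[K] E).toRingHom) =
      algebraMap B L (aevalTower (MvPolynomial.aeval z : MvPolynomial (Fin m) K →ₐ[K] B) b P) := by
  have hcomp : (algebraMap E L).comp
      (MvPolynomial.aeval zE : MvPolynomial (Fin m) K →ₐ[K] E).toRingHom =
      (algebraMap B L).comp (MvPolynomial.aeval z : MvPolynomial (Fin m) K →ₐ[K] B).toRingHom := by
    have h : (IsScalarTower.toAlgHom K E L).comp (MvPolynomial.aeval zE) =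
        (IsScalarTower.toAlgHom K B L).comp (MvPolynomial.aeval z) := by
      refine MvPolynomial.algHom_ext fun j => ?_
      simp [hzE j]
    exact congrArg AlgHom.toRingHom h
  rw [Polynomial.aeval_def, Polynomial.eval₂_map, hcomp, ← Polynomial.hom_eval₂]
  rfl

/-- **Separable Noether normalisation of a finite family over a perfect field** (Nagata (39.11);
Huneke–Swanson Thm. 4.2.2): for elements `x_1, …, x_n` of a domain `B` over a perfect field `K`,
mapped injectively into a field `L`, there are algebraically independent `y_1, …, y_e ∈ K[x]`
such that every `x_i` is integral over `K[y]` and separable over `K(y) ⊆ L`. Induction on `n`: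
a relation of minimal degree has a partial derivative not vanishing at `x`
(`MvPolynomial.exists_mem_support_not_dvd_of_forall_totalDegree_le`), the power shear with base
divisible by `p` makes that variable integral AND separable over the sheared rest
(`exists_monic_aevalTower_eq_zero_of_powShear`), and separability climbs the tower.
[cite: HunekeSwanson2006, Thm. 4.2.2] -/
theorem exists_isIntegral_isSeparable_adjoin (hinj : Function.Injective (algebraMap B L)) :
    ∀ (n : ℕ) (x : Fin n → B), ∃ (e : ℕ) (y : Fin e → B),
      (∀ i, y i ∈ Algebra.adjoin K (Set.range x)) ∧ AlgebraicIndependent K y ∧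
      (∀ i, IsIntegral (Algebra.adjoin K (Set.range y)) (x i)) ∧
      ∀ i, IsSeparable (IntermediateField.adjoin K (Set.range fun j => algebraMap B L (y j)))
        (algebraMap B L (x i)) := by
  intro n
  induction n with
  | zero =>
    intro x
    exact exists_isIntegral_isSeparable_adjoin_of_algebraicIndependent K x
      (algebraicIndependent_empty_type)
  | succ m ih =>
    intro x
    by_cases hx : AlgebraicIndependent K x
    · exact exists_isIntegral_isSeparable_adjoin_of_algebraicIndependent K x hx
    -- a relation of minimal total degree
    have haeval : ∀ F : MvPolynomial (Fin (m + 1)) K,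
        MvPolynomial.aeval (fun i => algebraMap B L (x i)) F =
          algebraMap B L (MvPolynomial.aeval x F) := fun F =>
      (DFunLike.congr_fun (MvPolynomial.comp_aeval x (IsScalarTower.toAlgHom K B L)) F).symm
    set S := {F : MvPolynomial (Fin (m + 1)) K | F ≠ 0 ∧ MvPolynomial.aeval x F = 0} with hS
    obtain ⟨f, ⟨hf0, hfx⟩, hfmin⟩ : ∃ F ∈ S, ∀ G : MvPolynomial (Fin (m + 1)) K, G ≠ 0 →
        MvPolynomial.aeval x G = 0 → F.totalDegree ≤ G.totalDegree := by
      have hne : S.Nonempty := by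
        rw [algebraicIndependent_iff] at hx
        obtain ⟨F, hF⟩ := not_forall.mp hx
        obtain ⟨hF0, hFne⟩ := Classical.not_imp.mp hF
        exact ⟨F, hFne, hF0⟩
      exact ⟨totalDegree.argminOn S hne, totalDegree.argminOn_mem .., fun G h₁ h₂ =>
        totalDegree.argminOn_le S (a := G) ⟨h₁, h₂⟩⟩
    -- an index whose partial derivative does not vanish at `x` (positive characteristic)
    obtain ⟨i, hi⟩ : ∃ i : Fin (m + 1), ∀ p : ℕ, p.Prime → CharP K p →
        MvPolynomial.aeval x (pderiv i f) ≠ 0 := by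
      obtain h0 | ⟨p, ⟨hp⟩, hpK⟩ := CharP.exists' K
      · refine ⟨0, fun p hp hpK => ?_⟩
        haveI := h0
        exact absurd (CharP.eq K hpK (CharP.ofCharZero K) ▸ hp) Nat.not_prime_zero
      · haveI := hpK
        have hfa : f.aeval (fun i => algebraMap B L (x i)) = 0 := by rw [haeval, hfx, map_zero]
        have hmin' : ∀ F' : MvPolynomial (Fin (m + 1)) K, F' ≠ 0 →
            F'.aeval (fun i => algebraMap B L (x i)) = 0 → f.totalDegree ≤ F'.totalDegree :=
          fun F' h1 h2 => hfmin F' h1 (hinj (by rw [← haeval, h2, map_zero]))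
        obtain ⟨i, σ, hσ, hndvd⟩ :=
          MvPolynomial.exists_mem_support_not_dvd_of_forall_totalDegree_le p hp
            (linearIndepOn_pow_of_perfectField (K := K) (L := L) p hp) hmin' hf0 hfa
        have hpd : pderiv i f ≠ 0 := pderiv_ne_zero_of_not_dvd (k := K) p hσ hndvd
        refine ⟨i, fun p' hp' hp'K => ?_⟩
        intro h0
        exact absurd (hfmin _ hpd h0) (not_le.mpr (totalDegree_pderiv_lt hpd))
    -- reindex so that this index is `0`
    set τ : Equiv.Perm (Fin (m + 1)) := Equiv.swap 0 i with hτ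
    set x' : Fin (m + 1) → B := x ∘ τ with hx'
    set f' : MvPolynomial (Fin (m + 1)) K := rename τ f with hf'
    have hττ : ∀ l, τ (τ l) = l := fun l => by rw [hτ, Equiv.swap_apply_self]
    have hxx' : x' ∘ τ = x := funext fun l => by simp only [hx', Function.comp_apply, hττ]
    have hf'0 : f' ≠ 0 := fun h => hf0 (rename_injective τ τ.injective (by rw [← hf', h, map_zero]))
    have hf'x : MvPolynomial.aeval x' f' = 0 := by rw [hf', MvPolynomial.aeval_rename, hxx', hfx]
    have hder' : ∀ p : ℕ, p.Prime → CharP K p → MvPolynomial.aeval x' (pderiv 0 f') ≠ 0 := by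
      intro p hp hpK
      have h0 : (0 : Fin (m + 1)) = τ i := by rw [hτ, Equiv.swap_apply_right]
      rw [h0, hf', pderiv_rename τ.injective, MvPolynomial.aeval_rename, hxx']
      exact hi p hp hpK
    -- the base of the shear
    obtain ⟨N, h1N, hNdeg, hNchar⟩ : ∃ N : ℕ, 1 < N ∧ (∀ j, ∀ v ∈ f'.support, v j < N) ∧
        ∀ p : ℕ, p.Prime → CharP K p → (N : K) = 0 := by
      have hlt : ∀ j, ∀ v ∈ f'.support, v j < f'.totalDegree + 2 := fun j v hv =>
        lt_of_le_of_lt ((monomial_le_degreeOf j hv).trans (degreeOf_le_totalDegree f' j)) (by omega)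
      obtain h0 | ⟨p, ⟨hp⟩, hpK⟩ := CharP.exists' K
      · refine ⟨f'.totalDegree + 2, by omega, hlt, fun p hp hpK => ?_⟩
        haveI := h0
        exact absurd (CharP.eq K hpK (CharP.ofCharZero K) ▸ hp) Nat.not_prime_zero
      · refine ⟨p * (f'.totalDegree + 2), ?_, fun j v hv => ?_, fun p' hp' hp'K => ?_⟩
        · have := hp.two_le; nlinarith
        · exact (hlt j v hv).trans_le (Nat.le_mul_of_pos_left _ hp.pos)
        · have : p' = p := CharP.eq K hp'K hpK
          subst this
          rw [Nat.cast_mul, CharP.cast_eq_zero, zero_mul]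
    -- the sheared family and the inductive hypothesis
    set z : Fin m → B := fun j => x' j.succ - x' 0 ^ (N ^ ((j : ℕ) + 1)) with hz
    have hint0 : IsIntegral (Algebra.adjoin K (Set.range z)) (x' 0) :=
      isIntegral_adjoin_powShear x' hf'0 hf'x h1N hNdeg z fun j => rfl
    obtain ⟨h, hmonic, hroot, hder⟩ :=
      exists_monic_aevalTower_eq_zero_of_powShear x' hf'0 hf'x h1N hNdeg z fun j => rfl
    obtain ⟨e, y, hyz, hyind, hzint, hzsep⟩ := ih z
    -- bookkeeping of subalgebras
    have hrange : Set.range x' = Set.range x := by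
      rw [hx', Set.range_comp, τ.surjective.range_eq, Set.image_univ]
    have hadj : Algebra.adjoin K (Set.range x) =
        Algebra.adjoin K (Set.range (Fin.cons (x' 0) z : Fin (m + 1) → B)) := by
      rw [← hrange]
      exact adjoin_range_eq_adjoin_cons_powShear x' N z fun j => rfl
    have hzle : Algebra.adjoin K (Set.range z) ≤ Algebra.adjoin K (Set.range x) := by
      rw [hadj]
      refine Algebra.adjoin_mono ?_
      rintro _ ⟨j, rfl⟩
      exact ⟨j.succ, by simp⟩
    refine ⟨e, y, fun j => hzle (hyz j), hyind, ?_, ?_⟩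
    · -- integrality over `K[y]`
      have hgen : ∀ s ∈ Set.range (Fin.cons (x' 0) z : Fin (m + 1) → B),
          IsIntegral (Algebra.adjoin K (Set.range y)) s := by
        rintro _ ⟨l, rfl⟩
        refine Fin.cases ?_ (fun j => ?_) l
        · rw [Fin.cons_zero]
          exact isIntegral_of_isIntegral_adjoin (by rintro _ ⟨j, rfl⟩; exact hzint j) hint0
        · rw [Fin.cons_succ]
          exact hzint j
      intro l
      refine isIntegral_of_mem_adjoin_of_forall_isIntegral hgen ?_
      rw [← hadj]
      exact Algebra.subset_adjoin ⟨l, rfl⟩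
    · -- separability over `K(y)`
      set Fy := IntermediateField.adjoin K (Set.range fun j => algebraMap B L (y j)) with hFy
      set E : IntermediateField Fy L := IntermediateField.adjoin Fy (Set.range fun j => algebraMap B L (z j))
        with hE
      haveI hEsep : Algebra.IsSeparable Fy E := by
        rw [hE, IntermediateField.isSeparable_adjoin_iff_isSeparable]
        rintro _ ⟨j, rfl⟩
        exact hzsep j
      have hzE : ∀ j, algebraMap B L (z j) ∈ E := fun j =>
        IntermediateField.subset_adjoin Fy _ ⟨j, rfl⟩
      let zE : Fin m → E := fun j => ⟨algebraMap B L (z j), hzE j⟩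
      haveI : IsScalarTower K E L := IsScalarTower.of_algebraMap_eq fun c => rfl
      -- `x'_0` is separable over `E = K(y)(z)`
      have hsep0 : IsSeparable E (algebraMap B L (x' 0)) := by
        set H : Polynomial E := h.map (MvPolynomial.aeval zE : MvPolynomial (Fin m) K →ₐ[K] E).toRingHom
          with hH
        have hH0 : Polynomial.aeval (algebraMap B L (x' 0)) H = 0 := by
          rw [hH, aeval_map_aeval_eq_algebraMap_aevalTower K E z zE (fun j => rfl), hroot, map_zero]
        obtain h0 | ⟨p, ⟨hp⟩, hpK⟩ := CharP.exists' K
        · -- characteristic zero: `E` is perfect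
          haveI := h0
          haveI : CharZero L := charZero_of_injective_algebraMap (algebraMap K L).injective
          haveI : CharZero E := inferInstance
          have hint : IsIntegral E (algebraMap B L (x' 0)) := ⟨H, hmonic.map _, by
            rw [← Polynomial.aeval_def]; exact hH0⟩
          exact PerfectField.separable_of_irreducible (minpoly.irreducible hint)
        · obtain ⟨u, hu, hderiv⟩ := hder (hNchar p hp hpK)
          refine isSeparable_of_aeval_derivative_ne_zero _ H hH0 ?_
          rw [hH, Polynomial.derivative_map,
            aeval_map_aeval_eq_algebraMap_aevalTower K E z zE (fun j => rfl), hderiv]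
          intro h0
          exact hder' p hp hpK (hu.mul_right_eq_zero.mp (hinj (by rw [h0, map_zero])))
      have hsep0' : IsSeparable Fy (algebraMap B L (x' 0)) :=
        IsSeparable.of_algebra_isSeparable_of_isSeparable Fy (E := E) hsep0
      -- every `x'_l` lies in `E⟮x'_0⟯`, which is separable over `E`, hence over `K(y)`
      haveI : Algebra.IsSeparable E E⟮algebraMap B L (x' 0)⟯ :=
        (IntermediateField.isSeparable_adjoin_simple_iff_isSeparable _ _).mpr hsep0
      have hmemE' : ∀ l, algebraMap B L (x' l) ∈ E⟮algebraMap B L (x' 0)⟯ := by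
        intro l
        refine Fin.cases ?_ (fun j => ?_) l
        · exact IntermediateField.mem_adjoin_simple_self E _
        · have : x' j.succ = z j + x' 0 ^ (N ^ ((j : ℕ) + 1)) := by rw [hz]; ring
          rw [this, map_add, map_pow]
          refine add_mem ?_ (pow_mem (IntermediateField.mem_adjoin_simple_self E _) _)
          exact IntermediateField.algebraMap_mem E⟮algebraMap B L (x' 0)⟯ (zE j)
      have hsepx' : ∀ l, IsSeparable Fy (algebraMap B L (x' l)) := fun l =>
        IsSeparable.of_algebra_isSeparable_of_isSeparable Fy (E := E)
          (IsSeparable.of_algebra_isSeparable_of_isSeparable E (E := E⟮algebraMap B L (x' 0)⟯)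
            (isSeparable_algebraMap (F := E⟮algebraMap B L (x' 0)⟯) ⟨_, hmemE' l⟩))
      intro l
      have : x l = x' (τ l) := by simp only [hx', Function.comp_apply, hττ]
      rw [this]
      exact hsepx' (τ l)

end SeparableNN

end Literature.RingTheory.NoetherNormalization

end
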